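import Summits.QuantumFields.YangMills.Theorems.BalabanUVNodesN15KingModelToronOperator
import Summits.QuantumFields.YangMills.Theorems.BalabanUVNodesN15KingModelFreeKernelThermodynamicLimit
import HarnessLib

/-!
# BalabanUVNodes ∕ N15 — THE KING-MODEL RUNG (PART Ͷ-f): THE TWISTED IMAGE SUM — the toron covariance is PART Ε-b's periodisation of the free lattice kernel `K_∞` with the
# HOLONOMY CHARACTER on the winding sectors: `(−cΔ_ω + m²)⁻¹(x,y) = ω̄^{x̃}·ω^{ỹ}·Σ_{n∈ℤ^{d+1}} (Π_μ ω̄_μ^{K_μn_μ})·K_∞(x̃ − ỹ + (K_μn_μ)_μ)` (every period vector, `c ≥ 0`,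
# `m² > 0`, every unit `ω`); hence Kato's inequality `|G_ω(x,y)| ≤ (lapF)⁻¹(x,y)` is the TRIANGLE INEQUALITY on the image sum, and at `ω = 1` the formula is Ε-b's
# (Track A, DAG node N15 = NE2; FAN-OUT v1.1 §N15 s3 «KING-MODEL RUNG … + what the curved case adds»; count-neutral)

HONEST FRAMING.  Count-neutral (cell `pub-ymgap`, seat `pub-ymgap-dag-n15-e` g44; `--supports stmt-QuantumFields-27247 --as helper` = K3ᴬ, KEY MAP v3).  One finite torus
`T = Π_μℤ∕K_μ`; King's `A = 0` free lattice kernel `K_∞` (PART Ε-a: [King1986] (2.13) p.653, §4 p.670 l.8–13 «… in terms of the operator … on the whole lattice …»;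
[Balaban1984PropagatorsI] p.36 l.20–23 «relating G on the torus to G on the whole lattice ηZ^d in the usual way») and its periodisation (PART Ε-b `lapF_inv_eq_tsum_freeKer`);
constant abelian `U(1)` link fields.  NOT Bałaban's `G_k(U)`; NOT a node discharge; nothing continuum ∕ ℝ⁴ ∕ OS ∕ Clay.

THE MECHANISM.  Gauging the constant link field away on the lift to `ℤ^{d+1}` (`u(z) = ω^{z}ṽ(z)`) turns the toron stencil into King's free stencil on functions that are
QUASI-PERIODIC with the holonomy, `u(z + K_μe_μ) = ω_μ^{K_μ}u(z)`; the free Green's function on such functions is the character-weighted image sum.  PROVED HERE directly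
on the torus as a column equation (no lift):
* §1 the LOCAL PHASE `locPhase ω z = Π_μω_μ^{z_μ}` and the HOLONOMY CHARACTER `holChar K ω n = Π_μ(ω_μ^{K_μ})^{n_μ}` (`z, n ∈ ℤ^{d+1}`, integer powers): `locPhase_translate`
  (`ω^{z+Kn} = ω^{z}·holChar n`), `locPhase_add_e`∕`_sub_e`, `holChar_add`, unit moduli, `exists_translate_of_dvd`;
* §2 the TWISTED IMAGE SUM `twistedSum c m² K ω w := Σ'_n conj(holChar K ω n)·K_∞(w + Kn)` (absolutely convergent by Ε-a's decay): `summable_twistedTerm`, ★ `twistedSum_translate`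
  (`Σ(w + Kn₀) = holChar n₀·Σ(w)` — quasi-periodicity), ★★ `twistedSum_green` (THE FREE STENCIL TERMWISE: `m²Σ(w) + cΣ_μ(2Σ(w) − Σ(w+e_μ) − Σ(w−e_μ)) = Σ'_n conj(holChar n)·[w + Kn = 0]`,
  Ε-a `freeKerC_green` under the sum), `twistedSum_green_torRepZ` (`= [x = y]` at `w = x̃ − ỹ`);
* §3 ★★ `toronOp_mulVec_twistedColumn` (the column equation `M_ω·G(·,y) = δ_y`: the wrap-around of `torRepZ(x ± e_μ)` produces a holonomy character from the local phase and the
  INVERSE character from the quasi-periodicity — they cancel), ★★★ **`toronOp_inv_eq_twistedImages`** — THE DISPLAYED FORMULA (every period vector, `c ≥ 0`, `m² > 0`, unit `ω`),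
  `covLapF_toronLink_inv_eq_twistedImages` (PART Ͱ's covariant covariance at the toron field); RECOVERY `twistedSum_one` ∕ ★ `toronOp_one_inv_eq_periodise` (at `ω ≡ 1`: PART Ε-b's
  `lapF_inv_eq_tsum_freeKer`, now for the reindexed `covLapF 1`);
* §4 ★★ **`norm_toronOp_inv_le_tsum_freeKer`** — KATO's INEQUALITY AS THE TRIANGLE INEQUALITY ON THE WINDING SECTORS: `|G_ω(x,y)| ≤ Σ_n K_∞(x̃ − ỹ + Kn) = (lapF)⁻¹(x,y)` (Ε-a
  `freeKer_nonneg`, Ε-b `lapF_inv_eq_tsum_freeKer`) — a second, independent proof of PART Ͱ-b's domination at torons, with the deficit visible: the image sum loses exactly the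
  cancellation between winding sectors of different holonomy phase.

PRIOR TREE ART (by name, not restated): Ͷ-a (`toronOp`, `toronLink`, `toronOp_mulVec_complex`, `siteEquiv`, `toronOp_inv_apply`), Ε-a (`freeKerC`, `freeKer`, `ofReal_freeKer`,
`freeKerC_green`, `summable_norm_freeKerC`, `norm_freeKerC_le`), Ε-b (`torRepZ`, `intCast_torRepZ`, `dvd_torRepZ_sub_iff`, `dvd_torRepZ_add_unitVec`, `dvd_torRepZ_sub_unitVec`,
`one_le_period`, `lapF_inv_eq_tsum_freeKer`), `…FreeKernelThermodynamicLimit.freeKer_nonneg`, `B4TorusKernel.MultiPeriod.translate`(`_apply`, `_injective`), `B4Green244.e`, Mathlib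
(`Equiv.tsum_eq`, `Summable.tsum_finsetSum`, `tsum_mul_left`, `Summable.of_norm`, `tsum_eq_single`, `norm_tsum_le_tsum_norm`, `zpow_add₀`, `zpow_mul`).  Dedup (rg at filing): basename 0
files; needles `locPhase|holChar|twistedSum|toronOp_inv_eq_twistedImages` 0 tree files.  Locators: [King1986] (2.13) p.653, §4 p.670 l.8–13, (4.4) p.670; [Balaban1984PropagatorsI]
p.36 l.20–23, (1.29) p.23; [Balaban1983RegularityDecay] (2.43) p.584; [Balaban1985BackgroundPropagators] (3.23) p.394; [tHooft1979Flux] NPB 153 (twisted boundary conditions; notion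
only).  0 `sorry`, 4 `def` (`locPhase`, `holChar`, `twistedSum`, `twistedColumn`).
-/

noncomputable section

open scoped BigOperators ComplexConjugate ComplexOrder
open Finset Matrix Complex

namespace Summit.QuantumFields.YangMills.BalabanUVNodes.N15KingModelRung.Toron

open Literature.MathematicalPhysics.QuantumFieldTheory.Balaban1983to89.B5Prop11Plancherel
open Literature.MathematicalPhysics.QuantumFieldTheory.Balaban1983to89.B4Green244 (e)
open Literature.MathematicalPhysics.QuantumFieldTheory.Balaban1983to89.B4TorusKernel.MultiPeriod (translate translate_injective)
open Literature.MathematicalPhysics.QuantumFieldTheory.Balaban1983to89.B4TorusKernel.MultiPeriod renaming translate_apply → translateK_apply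
open Literature.MathematicalPhysics.QuantumFieldTheory.King1986.Torus (lapF)
open Summit.QuantumFields.YangMills.BalabanUVNodes.N15KingModelRung.Covariant (covLapF)
open Summit.QuantumFields.YangMills.BalabanUVNodes.N15KingModelRung.TorusSpectral (freeKerC freeKer ofReal_freeKer freeKerC_green summable_norm_freeKerC torRepZ intCast_torRepZ
  dvd_torRepZ_sub_iff dvd_torRepZ_add_unitVec dvd_torRepZ_sub_unitVec one_le_period lapF_inv_eq_tsum_freeKer freeKer_nonneg summable_freeKer_translate)

variable {d : ℕ} (K : Fin (d + 1) → ℕ)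

/-! ## §1 The local phase and the holonomy character -/
section Phases

/-- THE LOCAL PHASE `ω^{z} = Π_μ ω_μ^{z_μ}` (`z ∈ ℤ^{d+1}`, integer powers): the straight-line parallel transport of the constant link field from the origin to `z`.
[cite: Balaban1985BackgroundPropagators, (3.3) p.391] -/
def locPhase (ω : Fin (d + 1) → ℂ) (z : Fin (d + 1) → ℤ) : ℂ := ∏ μ, ω μ ^ z μ

/-- THE HOLONOMY CHARACTER of the winding sector `n ∈ ℤ^{d+1}`: `Π_μ (ω_μ^{K_μ})^{n_μ}`. [cite: tHooft1979Flux, NPB 153 (twisted boundary conditions)] -/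
def holChar (ω : Fin (d + 1) → ℂ) (n : Fin (d + 1) → ℤ) : ℂ := ∏ μ, (ω μ ^ K μ) ^ n μ

variable {K}

/-- Unit phases are non-zero. [folklore] -/
theorem ne_zero_of_norm_eq_one {ω : Fin (d + 1) → ℂ} (hω : ∀ μ, ‖ω μ‖ = 1) (μ : Fin (d + 1)) : ω μ ≠ 0 := fun h => by
  have := hω μ; rw [h, norm_zero] at this; exact zero_ne_one this

variable (K)

/-- ★ `ω^{z + Kn} = ω^{z}·holChar n`: translating by a period vector multiplies the local phase by the holonomy character. [folklore] -/
theorem locPhase_translate {ω : Fin (d + 1) → ℂ} (hω : ∀ μ, ‖ω μ‖ = 1) (z n : Fin (d + 1) → ℤ) :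
    locPhase ω (translate K z n) = locPhase ω z * holChar K ω n := by
  rw [locPhase, locPhase, holChar, ← Finset.prod_mul_distrib]
  exact Finset.prod_congr rfl fun μ _ => by rw [translateK_apply, zpow_add₀ (ne_zero_of_norm_eq_one hω μ), _root_.zpow_mul, zpow_natCast]

omit K in
/-- `ω^{z + e_μ} = ω^{z}·ω_μ`. [folklore] -/
theorem locPhase_add_e {ω : Fin (d + 1) → ℂ} (hω : ∀ μ, ‖ω μ‖ = 1) (z : Fin (d + 1) → ℤ) (μ : Fin (d + 1)) :
    locPhase ω (z + e μ) = locPhase ω z * ω μ := by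
  unfold locPhase
  have h : ∀ ν, ω ν ^ (z + e μ) ν = ω ν ^ z ν * (if ν = μ then ω μ else 1) := fun ν => by
    rw [Pi.add_apply, zpow_add₀ (ne_zero_of_norm_eq_one hω ν)]
    congr 1
    unfold e
    by_cases hν : ν = μ
    · subst hν; simp
    · simp [hν]
  simp_rw [h]
  rw [Finset.prod_mul_distrib, Finset.prod_ite_eq' Finset.univ μ (fun _ => ω μ), if_pos (Finset.mem_univ μ)]

omit K in
/-- `ω^{z − e_μ} = ω^{z}·ω_μ⁻¹`. [folklore] -/
theorem locPhase_sub_e {ω : Fin (d + 1) → ℂ} (hω : ∀ μ, ‖ω μ‖ = 1) (z : Fin (d + 1) → ℤ) (μ : Fin (d + 1)) :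
    locPhase ω (z - e μ) = locPhase ω z * (ω μ)⁻¹ := by
  have h := locPhase_add_e hω (z - e μ) μ
  rw [sub_add_cancel] at h
  rw [h, mul_assoc, mul_inv_cancel₀ (ne_zero_of_norm_eq_one hω μ), mul_one]

/-- `holChar (n + n′) = holChar n·holChar n′`. [folklore] -/
theorem holChar_add {ω : Fin (d + 1) → ℂ} (hω : ∀ μ, ‖ω μ‖ = 1) (n n' : Fin (d + 1) → ℤ) : holChar K ω (n + n') = holChar K ω n * holChar K ω n' := by
  rw [holChar, holChar, holChar, ← Finset.prod_mul_distrib]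
  exact Finset.prod_congr rfl fun μ _ => by rw [Pi.add_apply, zpow_add₀ (pow_ne_zero _ (ne_zero_of_norm_eq_one hω μ))]

/-- `holChar 0 = 1`. [folklore] -/
theorem holChar_zero (ω : Fin (d + 1) → ℂ) : holChar K ω 0 = 1 := by simp [holChar]

/-- `|holChar n| = 1`. [folklore] -/
theorem norm_holChar {ω : Fin (d + 1) → ℂ} (hω : ∀ μ, ‖ω μ‖ = 1) (n : Fin (d + 1) → ℤ) : ‖holChar K ω n‖ = 1 := by
  rw [holChar, norm_prod, Finset.prod_eq_one fun μ _ => by rw [norm_zpow, norm_pow, hω, one_pow, _root_.one_zpow]]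

omit K in
/-- `|ω^{z}| = 1`. [folklore] -/
theorem norm_locPhase {ω : Fin (d + 1) → ℂ} (hω : ∀ μ, ‖ω μ‖ = 1) (z : Fin (d + 1) → ℤ) : ‖locPhase ω z‖ = 1 := by
  rw [locPhase, norm_prod, Finset.prod_eq_one fun μ _ => by rw [norm_zpow, hω, _root_.one_zpow]]

/-- For a unit-modulus number `conj u⁻¹ = u`. [folklore] -/
theorem conj_inv_of_norm_eq_one {u : ℂ} (hu : ‖u‖ = 1) : conj u⁻¹ = u := by
  rw [map_inv₀]; exact inv_eq_of_mul_eq_one_left (by rw [Complex.mul_conj', hu]; norm_num)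

/-- A coordinatewise congruence `w ≡ w′ (mod K)` is a translation by a period vector: `w = w′ + Kn`. [folklore] -/
theorem exists_translate_of_dvd {w w' : Fin (d + 1) → ℤ} (h : ∀ ν, (K ν : ℤ) ∣ w ν - w' ν) : ∃ n : Fin (d + 1) → ℤ, w = translate K w' n := by
  choose n hn using h
  refine ⟨n, funext fun ν => ?_⟩
  rw [translateK_apply, ← hn ν]; ring

end Phases

/-! ## §2 The twisted image sum and the free stencil termwise -/
section TwistedSum

variable [hK : ∀ μ, NeZero (K μ)] {c m2 : ℝ}

/-- THE TWISTED IMAGE SUM `Σ'_{n∈ℤ^{d+1}} conj(holChar n)·K_∞(w + Kn)` — the holonomy-character-weighted periodisation of the free lattice kernel.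
[cite: King1986, §4 p.670 l.8–13; Balaban1984PropagatorsI, p.36 l.20–23; tHooft1979Flux, NPB 153] -/
def twistedSum (c m2 : ℝ) (ω : Fin (d + 1) → ℂ) (w : Fin (d + 1) → ℤ) : ℂ := ∑' n : Fin (d + 1) → ℤ, conj (holChar K ω n) * freeKerC c m2 (translate K w n)

/-- Each twisted family is absolutely summable (unit weights × Ε-a's summable kernel along an injective translation class). [folklore] -/
theorem summable_twistedTerm (hc : 0 ≤ c) (hm : 0 < m2) {ω : Fin (d + 1) → ℂ} (hω : ∀ μ, ‖ω μ‖ = 1) (w : Fin (d + 1) → ℤ) :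
    Summable fun n : Fin (d + 1) → ℤ => conj (holChar K ω n) * freeKerC c m2 (translate K w n) := by
  refine Summable.of_norm ?_
  have h := (summable_norm_freeKerC (d := d) hc hm).comp_injective (translate_injective (one_le_period K) w)
  refine h.congr fun n => ?_
  simp only [Function.comp_apply, norm_mul, Complex.norm_conj, norm_holChar K hω, one_mul]

omit hK in
/-- `translate` is additive in the winding vector: `w + K(n₀ + n) = (w + Kn₀) + Kn`. [folklore] -/
theorem translate_translate (w n₀ n : Fin (d + 1) → ℤ) : translate K (translate K w n₀) n = translate K w (n₀ + n) := by funext ν; simp only [translateK_apply, Pi.add_apply]; ring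

omit hK in
/-- `translate` commutes with adding a fixed vector: `(w + a) + Kn = (w + Kn) + a`. [folklore] -/
theorem translate_add (w a n : Fin (d + 1) → ℤ) : translate K (w + a) n = translate K w n + a := by funext ν; simp only [translateK_apply, Pi.add_apply]; ring

omit hK in
/-- … and with subtracting one. [folklore] -/
theorem translate_sub (w a n : Fin (d + 1) → ℤ) : translate K (w - a) n = translate K w n - a := by funext ν; simp only [translateK_apply, Pi.sub_apply]; ring

omit hK in
/-- ★ QUASI-PERIODICITY: `Σ(w + Kn₀) = holChar n₀·Σ(w)` — translating the argument by a period vector reindexes the winding sectors and pulls out a holonomy character.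
[cite: tHooft1979Flux, NPB 153 (twisted boundary conditions)] -/
theorem twistedSum_translate {ω : Fin (d + 1) → ℂ} (hω : ∀ μ, ‖ω μ‖ = 1) (w n₀ : Fin (d + 1) → ℤ) :
    twistedSum K c m2 ω (translate K w n₀) = holChar K ω n₀ * twistedSum K c m2 ω w := by
  unfold twistedSum
  simp_rw [translate_translate]
  rw [← Equiv.tsum_eq (Equiv.addLeft n₀).symm]
  rw [← tsum_mul_left]
  refine tsum_congr fun n => ?_
  have hn : n₀ + (Equiv.addLeft n₀).symm n = n := by simp
  rw [hn, show (Equiv.addLeft n₀).symm n = -n₀ + n by simp, holChar_add K hω, map_mul]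
  have hneg : conj (holChar K ω (-n₀)) = holChar K ω n₀ := by
    have h1 : holChar K ω (-n₀) * holChar K ω n₀ = 1 := by rw [← holChar_add K hω, neg_add_cancel, holChar_zero]
    have h2 : holChar K ω (-n₀) = (holChar K ω n₀)⁻¹ := eq_inv_of_mul_eq_one_left h1
    rw [h2, conj_inv_of_norm_eq_one (norm_holChar K hω n₀)]
  rw [hneg]; ring

/-- ★★ **THE FREE STENCIL UNDER THE TWISTED SUM**: `m²Σ(w) + cΣ_μ(2Σ(w) − Σ(w+e_μ) − Σ(w−e_μ)) = Σ'_n conj(holChar n)·[w + Kn = 0]` (Ε-a's Green equation termwise; all families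
absolutely summable). [cite: King1986, (2.13) p.653, §4 p.670 l.8–13; Balaban1983RegularityDecay, (2.43) p.584] -/
theorem twistedSum_green (hc : 0 ≤ c) (hm : 0 < m2) {ω : Fin (d + 1) → ℂ} (hω : ∀ μ, ‖ω μ‖ = 1) (w : Fin (d + 1) → ℤ) :
    (m2 : ℂ) * twistedSum K c m2 ω w + (c : ℂ) * ∑ μ, (2 * twistedSum K c m2 ω w - twistedSum K c m2 ω (w + e μ) - twistedSum K c m2 ω (w - e μ))
      = ∑' n : Fin (d + 1) → ℤ, conj (holChar K ω n) * (if translate K w n = 0 then 1 else 0) := by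
  have hS := fun w' => summable_twistedTerm K hc hm hω w'
  -- every term on the right is the conj-character times the Green expression at `translate K w n`
  have hterm : ∀ n : Fin (d + 1) → ℤ, conj (holChar K ω n) * (if translate K w n = 0 then (1 : ℂ) else 0)
      = (m2 : ℂ) * (conj (holChar K ω n) * freeKerC c m2 (translate K w n))
        + (c : ℂ) * ∑ μ, (2 * (conj (holChar K ω n) * freeKerC c m2 (translate K w n))
            - conj (holChar K ω n) * freeKerC c m2 (translate K (w + e μ) n) - conj (holChar K ω n) * freeKerC c m2 (translate K (w - e μ) n)) := by
    intro n
    rw [← freeKerC_green (d := d) hc hm (translate K w n)]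
    simp_rw [translate_add, translate_sub]
    simp only [mul_add, Finset.mul_sum]
    congr 1
    · ring
    · exact Finset.sum_congr rfl fun μ _ => by ring
  rw [tsum_congr hterm]
  have hA : Summable fun n : Fin (d + 1) → ℤ => (m2 : ℂ) * (conj (holChar K ω n) * freeKerC c m2 (translate K w n)) := (hS w).mul_left _
  have hBμ : ∀ μ : Fin (d + 1), Summable fun n : Fin (d + 1) → ℤ => (2 * (conj (holChar K ω n) * freeKerC c m2 (translate K w n))
      - conj (holChar K ω n) * freeKerC c m2 (translate K (w + e μ) n) - conj (holChar K ω n) * freeKerC c m2 (translate K (w - e μ) n)) :=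
    fun μ => (((hS w).mul_left 2).sub (hS (w + e μ))).sub (hS (w - e μ))
  have hB : Summable fun n : Fin (d + 1) → ℤ => (c : ℂ) * ∑ μ, (2 * (conj (holChar K ω n) * freeKerC c m2 (translate K w n))
      - conj (holChar K ω n) * freeKerC c m2 (translate K (w + e μ) n) - conj (holChar K ω n) * freeKerC c m2 (translate K (w - e μ) n)) :=
    (summable_sum fun μ _ => hBμ μ).mul_left _
  rw [hA.tsum_add hB, tsum_mul_left, tsum_mul_left, Summable.tsum_finsetSum (fun μ _ => hBμ μ)]
  congr 2
  refine Finset.sum_congr rfl fun μ _ => ?_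
  rw [(((hS w).mul_left 2).sub (hS (w + e μ))).tsum_sub (hS (w - e μ)), ((hS w).mul_left 2).tsum_sub (hS (w + e μ)), tsum_mul_left]
  rfl

/-- On box representatives the right side is `[x = y]`: `x̃ − ỹ + Kn = 0` forces `x = y` and then `n = 0`. [folklore] -/
theorem tsum_holChar_indicator_torRepZ {ω : Fin (d + 1) → ℂ} (x y : Tor K) :
    ∑' n : Fin (d + 1) → ℤ, conj (holChar K ω n) * (if translate K (torRepZ K x - torRepZ K y) n = 0 then (1 : ℂ) else 0) = if x = y then 1 else 0 := by
  by_cases hxy : x = y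
  · subst hxy
    rw [if_pos rfl, sub_self]
    rw [tsum_eq_single 0]
    · have h0 : translate K (0 : Fin (d + 1) → ℤ) 0 = 0 := by funext ν; simp [translateK_apply]
      rw [h0, if_pos rfl, holChar_zero, map_one, one_mul]
    · intro n hn
      rw [if_neg, mul_zero]
      intro h0
      apply hn
      funext ν
      have := congr_fun h0 ν
      rw [translateK_apply, Pi.zero_apply, zero_add] at this
      rcases mul_eq_zero.mp this with h | h
      · exact absurd h (by exact_mod_cast (NeZero.ne (K ν)))
      · exact h
  · rw [if_neg hxy]
    rw [tsum_congr (g := fun _ : Fin (d + 1) → ℤ => (0 : ℂ)) fun n => ?_, tsum_zero]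
    rw [if_neg, mul_zero]
    intro h0
    apply hxy
    refine (dvd_torRepZ_sub_iff K x y).mp fun μ => ?_
    have := congr_fun h0 μ
    rw [translateK_apply, Pi.zero_apply] at this
    exact ⟨-n μ, by linarith⟩

/-- THE FREE STENCIL OF THE TWISTED SUM ON BOX REPRESENTATIVES: `m²Σ(x̃−ỹ) + cΣ_μ(2Σ(x̃−ỹ) − Σ(x̃−ỹ+e_μ) − Σ(x̃−ỹ−e_μ)) = [x = y]`. [cite: King1986, (4.4) p.670] -/
theorem twistedSum_green_torRepZ (hc : 0 ≤ c) (hm : 0 < m2) {ω : Fin (d + 1) → ℂ} (hω : ∀ μ, ‖ω μ‖ = 1) (x y : Tor K) :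
    (m2 : ℂ) * twistedSum K c m2 ω (torRepZ K x - torRepZ K y)
        + (c : ℂ) * ∑ μ, (2 * twistedSum K c m2 ω (torRepZ K x - torRepZ K y) - twistedSum K c m2 ω (torRepZ K x - torRepZ K y + e μ)
            - twistedSum K c m2 ω (torRepZ K x - torRepZ K y - e μ))
      = if x = y then 1 else 0 := by
  rw [twistedSum_green K hc hm hω, tsum_holChar_indicator_torRepZ]

end TwistedSum

/-! ## §3 The column equation on the torus and the inverse -/
section Column

variable [hK : ∀ μ, NeZero (K μ)] {c m2 : ℝ}

/-- THE CANDIDATE COLUMN `G(·,y) = ω̄^{x̃}·ω^{ỹ}·Σ(x̃ − ỹ)`. [cite: King1986, §4 p.670 l.8–13] -/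
def twistedColumn (c m2 : ℝ) (ω : Fin (d + 1) → ℂ) (x y : Tor K) : ℂ :=
  conj (locPhase ω (torRepZ K x)) * locPhase ω (torRepZ K y) * twistedSum K c m2 ω (torRepZ K x - torRepZ K y)

/-- The forward neighbour: `ω_μ·G(x+e_μ, y) = ω̄^{x̃}ω^{ỹ}·Σ(x̃ − ỹ + e_μ)` — the wrap-around of the representative contributes `conj(holChar n)` through the local phase and
`holChar n` through the quasi-periodicity; they cancel. [cite: tHooft1979Flux, NPB 153 (twisted boundary conditions)] -/
theorem forward_twistedColumn {ω : Fin (d + 1) → ℂ} (hω : ∀ μ, ‖ω μ‖ = 1) (x y : Tor K) (μ : Fin (d + 1)) :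
    ω μ * twistedColumn K c m2 ω (x + unitVec K μ) y
      = conj (locPhase ω (torRepZ K x)) * locPhase ω (torRepZ K y) * twistedSum K c m2 ω (torRepZ K x - torRepZ K y + e μ) := by
  obtain ⟨n, hn⟩ := exists_translate_of_dvd K (w := torRepZ K (x + unitVec K μ)) (w' := torRepZ K x + e μ) fun ν => by
    have := dvd_torRepZ_add_unitVec K x μ ν; rwa [Pi.add_apply]
  unfold twistedColumn
  rw [hn, show translate K (torRepZ K x + e μ) n - torRepZ K y = translate K (torRepZ K x - torRepZ K y + e μ) n by
      rw [← translate_sub]; congr 1; abel,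
    twistedSum_translate K hω, locPhase_translate K hω, locPhase_add_e hω, map_mul, map_mul]
  have h1 : conj (holChar K ω n) * holChar K ω n = 1 := by rw [Complex.conj_mul', norm_holChar K hω n]; norm_num
  have h2 : ω μ * conj (ω μ) = 1 := by rw [Complex.mul_conj', hω μ]; norm_num
  calc ω μ * (conj (locPhase ω (torRepZ K x)) * conj (ω μ) * conj (holChar K ω n) * locPhase ω (torRepZ K y)
        * (holChar K ω n * twistedSum K c m2 ω (torRepZ K x - torRepZ K y + e μ)))
      = (ω μ * conj (ω μ)) * (conj (holChar K ω n) * holChar K ω n)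
          * (conj (locPhase ω (torRepZ K x)) * locPhase ω (torRepZ K y) * twistedSum K c m2 ω (torRepZ K x - torRepZ K y + e μ)) := by ring
    _ = _ := by rw [h1, h2, one_mul, one_mul]

/-- The backward neighbour: `ω̄_μ·G(x−e_μ, y) = ω̄^{x̃}ω^{ỹ}·Σ(x̃ − ỹ − e_μ)`. [cite: tHooft1979Flux, NPB 153 (twisted boundary conditions)] -/
theorem backward_twistedColumn {ω : Fin (d + 1) → ℂ} (hω : ∀ μ, ‖ω μ‖ = 1) (x y : Tor K) (μ : Fin (d + 1)) :
    conj (ω μ) * twistedColumn K c m2 ω (x - unitVec K μ) y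
      = conj (locPhase ω (torRepZ K x)) * locPhase ω (torRepZ K y) * twistedSum K c m2 ω (torRepZ K x - torRepZ K y - e μ) := by
  obtain ⟨n, hn⟩ := exists_translate_of_dvd K (w := torRepZ K (x - unitVec K μ)) (w' := torRepZ K x - e μ) fun ν => by
    have := dvd_torRepZ_sub_unitVec K x μ ν; rwa [Pi.sub_apply]
  unfold twistedColumn
  rw [hn, show translate K (torRepZ K x - e μ) n - torRepZ K y = translate K (torRepZ K x - torRepZ K y - e μ) n by
      rw [← translate_sub]; congr 1; abel,
    twistedSum_translate K hω, locPhase_translate K hω, locPhase_sub_e hω, map_mul, map_mul, conj_inv_of_norm_eq_one (hω μ)]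
  have h1 : conj (holChar K ω n) * holChar K ω n = 1 := by rw [Complex.conj_mul', norm_holChar K hω n]; norm_num
  have h2 : conj (ω μ) * ω μ = 1 := by rw [Complex.conj_mul', hω μ]; norm_num
  calc conj (ω μ) * (conj (locPhase ω (torRepZ K x)) * ω μ * conj (holChar K ω n) * locPhase ω (torRepZ K y)
        * (holChar K ω n * twistedSum K c m2 ω (torRepZ K x - torRepZ K y - e μ)))
      = (conj (ω μ) * ω μ) * (conj (holChar K ω n) * holChar K ω n)
          * (conj (locPhase ω (torRepZ K x)) * locPhase ω (torRepZ K y) * twistedSum K c m2 ω (torRepZ K x - torRepZ K y - e μ)) := by ring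
    _ = _ := by rw [h1, h2, one_mul, one_mul]

/-- ★★ THE COLUMN EQUATION `M_ω·G(·,y) = δ_y`. [cite: King1986, (4.4) p.670, §4 p.670 l.8–13] -/
theorem toronOp_mulVec_twistedColumn (hc : 0 ≤ c) (hm : 0 < m2) {ω : Fin (d + 1) → ℂ} (hω : ∀ μ, ‖ω μ‖ = 1) (y : Tor K) :
    toronOp K c m2 ω *ᵥ (fun x => twistedColumn K c m2 ω x y) = fun x => if x = y then 1 else 0 := by
  funext x
  rw [toronOp_mulVec_complex]
  simp_rw [forward_twistedColumn K hω, backward_twistedColumn K hω]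
  rw [← twistedSum_green_torRepZ K hc hm hω x y]
  have hxx : x = y → conj (locPhase ω (torRepZ K x)) * locPhase ω (torRepZ K y) = 1 := fun h => by
    subst h; rw [Complex.conj_mul', norm_locPhase hω]; norm_num
  -- both sides are `ω̄^{x̃}ω^{ỹ}·(free stencil of Σ)`, except that at `x ≠ y` the stencil vanishes and at `x = y` the phase is `1`
  have key : ((m2 + 2 * ((d : ℝ) + 1) * c : ℝ) : ℂ) * twistedColumn K c m2 ω x y
        - (c : ℂ) * ∑ μ, (conj (locPhase ω (torRepZ K x)) * locPhase ω (torRepZ K y) * twistedSum K c m2 ω (torRepZ K x - torRepZ K y + e μ)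
            + conj (locPhase ω (torRepZ K x)) * locPhase ω (torRepZ K y) * twistedSum K c m2 ω (torRepZ K x - torRepZ K y - e μ))
      = conj (locPhase ω (torRepZ K x)) * locPhase ω (torRepZ K y)
          * ((m2 : ℂ) * twistedSum K c m2 ω (torRepZ K x - torRepZ K y)
            + (c : ℂ) * ∑ μ, (2 * twistedSum K c m2 ω (torRepZ K x - torRepZ K y) - twistedSum K c m2 ω (torRepZ K x - torRepZ K y + e μ)
                - twistedSum K c m2 ω (torRepZ K x - torRepZ K y - e μ))) := by
    unfold twistedColumn
    simp only [Finset.mul_sum, Finset.sum_sub_distrib, Finset.sum_add_distrib, mul_add, mul_sub, Finset.sum_const, Finset.card_univ, Fintype.card_fin, nsmul_eq_mul]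
    push_cast
    ring
  rw [key, twistedSum_green_torRepZ K hc hm hω x y]
  by_cases h : x = y
  · rw [if_pos h, hxx h, one_mul]
  · rw [if_neg h, mul_zero]

/-- `M_ω·G = 1`. [cite: King1986, (4.4) p.670] -/
theorem toronOp_mul_twistedColumn (hc : 0 ≤ c) (hm : 0 < m2) {ω : Fin (d + 1) → ℂ} (hω : ∀ μ, ‖ω μ‖ = 1) :
    toronOp K c m2 ω * Matrix.of (twistedColumn K c m2 ω) = 1 := by
  ext x y
  have h := congr_fun (toronOp_mulVec_twistedColumn K hc hm hω y) x
  rw [Matrix.mul_apply', Matrix.one_apply]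
  simpa only [Matrix.mulVec, dotProduct, Matrix.of_apply] using h

/-- ★★★ **THE TORON COVARIANCE IS THE HOLONOMY-TWISTED PERIODISATION OF THE FREE LATTICE KERNEL**: for every period vector, `c ≥ 0`, `m² > 0` and every unit `ω`,
`(−cΔ_ω + m²)⁻¹(x,y) = conj(ω^{x̃})·ω^{ỹ}·Σ'_{n∈ℤ^{d+1}} conj(Π_μ(ω_μ^{K_μ})^{n_μ})·K_∞(x̃ − ỹ + Kn)`, `x̃ = torRepZ x`.
[cite: King1986, (2.13) p.653, §4 p.670 l.8–13; Balaban1984PropagatorsI, p.36 l.20–23; Balaban1983RegularityDecay, (2.43) p.584; tHooft1979Flux, NPB 153] -/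
theorem toronOp_inv_eq_twistedImages (hc : 0 ≤ c) (hm : 0 < m2) {ω : Fin (d + 1) → ℂ} (hω : ∀ μ, ‖ω μ‖ = 1) :
    (toronOp K c m2 ω)⁻¹ = Matrix.of (twistedColumn K c m2 ω) :=
  Matrix.inv_eq_right_inv (toronOp_mul_twistedColumn K hc hm hω)

/-- Entrywise. [cite: King1986, §4 p.670 l.8–13] -/
theorem toronOp_inv_apply_eq_twistedImages (hc : 0 ≤ c) (hm : 0 < m2) {ω : Fin (d + 1) → ℂ} (hω : ∀ μ, ‖ω μ‖ = 1) (x y : Tor K) :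
    (toronOp K c m2 ω)⁻¹ x y
      = conj (locPhase ω (torRepZ K x)) * locPhase ω (torRepZ K y)
          * ∑' n : Fin (d + 1) → ℤ, conj (holChar K ω n) * freeKerC c m2 (translate K (torRepZ K x - torRepZ K y) n) := by
  rw [toronOp_inv_eq_twistedImages K hc hm hω]; rfl

/-- PART Ͱ's covariant fine covariance at the toron field, entrywise, as the twisted image sum. [cite: Balaban1985BackgroundPropagators, (3.23) p.394; King1986, §4 p.670 l.8–13] -/
theorem covLapF_toronLink_inv_eq_twistedImages (hc : 0 ≤ c) (hm : 0 < m2) {ω : Fin (d + 1) → ℂ} (hω : ∀ μ, ‖ω μ‖ = 1) (x y : Tor K) :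
    (covLapF K c m2 (toronLink K ω))⁻¹ (x, ()) (y, ()) = twistedColumn K c m2 ω x y := by
  rw [← toronOp_inv_apply, toronOp_inv_eq_twistedImages K hc hm hω]; rfl

omit hK in
/-- RECOVERY: at `ω ≡ 1` the twisted sum is the plain periodisation of `K_∞`. [cite: King1986, §4 p.670 l.8–13] -/
theorem twistedSum_one (c m2 : ℝ) (w : Fin (d + 1) → ℤ) : twistedSum K c m2 (fun _ => (1 : ℂ)) w = ∑' n : Fin (d + 1) → ℤ, freeKerC c m2 (translate K w n) := by
  unfold twistedSum; refine tsum_congr fun n => ?_; simp [holChar]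

/-- ★ RECOVERY OF PART Ε-b: at `ω ≡ 1`, `(toronOp K c m² 1)⁻¹(x,y) = Σ'_n K_∞(x̃ − ỹ + Kn) = (lapF K c m²)⁻¹(x,y)`. [cite: King1986, (4.4) p.670, §4 p.670 l.8–13] -/
theorem toronOp_one_inv_eq_periodise (hc : 0 ≤ c) (hm : 0 < m2) (x y : Tor K) :
    (toronOp K c m2 (fun _ => (1 : ℂ)))⁻¹ x y = (((lapF K c m2)⁻¹ x y : ℝ) : ℂ) := by
  rw [toronOp_inv_apply_eq_twistedImages K hc hm (fun _ => by simp), lapF_inv_eq_tsum_freeKer K hc hm, Complex.ofReal_tsum]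
  have hφ : ∀ z, locPhase (fun _ : Fin (d + 1) => (1 : ℂ)) z = 1 := fun z => by simp [locPhase]
  rw [hφ, hφ, map_one, one_mul, one_mul]
  refine tsum_congr fun n => ?_
  rw [holChar]; simp [ofReal_freeKer]

end Column

/-! ## §4 Kato's inequality as the triangle inequality on the winding sectors -/
section Kato

variable [hK : ∀ μ, NeZero (K μ)] {c m2 : ℝ}

/-- `|Σ(w)| ≤ Σ'_n K_∞(w + Kn)` (unit characters, `K_∞ ≥ 0`). [cite: King1986, (4.4) p.670] -/
theorem norm_twistedSum_le (hc : 0 ≤ c) (hm : 0 < m2) {ω : Fin (d + 1) → ℂ} (hω : ∀ μ, ‖ω μ‖ = 1) (w : Fin (d + 1) → ℤ) :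
    ‖twistedSum K c m2 ω w‖ ≤ ∑' n : Fin (d + 1) → ℤ, freeKer c m2 (translate K w n) := by
  unfold twistedSum
  refine le_trans (norm_tsum_le_tsum_norm (summable_twistedTerm K hc hm hω w).norm) (le_of_eq (tsum_congr fun n => ?_))
  rw [norm_mul, Complex.norm_conj, norm_holChar K hω, one_mul, ← ofReal_freeKer, Complex.norm_real, Real.norm_eq_abs, abs_of_nonneg (freeKer_nonneg hc hm _)]

/-- ★★ **KATO's INEQUALITY AT A TORON, FROM THE IMAGE SUM**: `|(−cΔ_ω+m²)⁻¹(x,y)| ≤ Σ'_n K_∞(x̃ − ỹ + Kn) = (lapF K c m²)⁻¹(x,y)` — the triangle inequality over the winding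
sectors (an independent proof of PART Ͱ-b's domination for constant link fields; the deficit is the cancellation between sectors of different holonomy phase).
[cite: DodziukMathai2006, §1 Thm 1.5; King1986, (4.4) p.670, §4 p.670 l.8–13] -/
theorem norm_toronOp_inv_le_tsum_freeKer (hc : 0 ≤ c) (hm : 0 < m2) {ω : Fin (d + 1) → ℂ} (hω : ∀ μ, ‖ω μ‖ = 1) (x y : Tor K) :
    ‖(toronOp K c m2 ω)⁻¹ x y‖ ≤ (lapF K c m2)⁻¹ x y := by
  rw [toronOp_inv_eq_twistedImages K hc hm hω, Matrix.of_apply, twistedColumn, norm_mul, norm_mul, Complex.norm_conj, norm_locPhase hω, norm_locPhase hω, one_mul, one_mul,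
    lapF_inv_eq_tsum_freeKer K hc hm]
  exact norm_twistedSum_le K hc hm hω _

end Kato

end Summit.QuantumFields.YangMills.BalabanUVNodes.N15KingModelRung.Toron

end
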